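import Mathlib
import Literature.MathematicalPhysics.QuantumFieldTheory.Balaban1983to89.B4

/-!
# B4 Sect. 5 Theorem (T. Bałaban, CMP **89** (1983) 571–597, p. 594, (5.6)–(5.10)) — the UNIFORM reading
# `B4.Sect5ThmUniform d N`, via COERCIVITY + EXPONENTIAL CONJUGATION (Combes–Thomas) instead of the print's random walk.

Seat `cruxidea-stmt-QuantumFields-20541-4` (planner, round-2 «transfer» seat; crux workfile, NOT a Literature∕Theorems proposal).
HONEST LINE: this file proves an ABSTRACT finite-dimensional linear-algebra theorem about symmetric coercive kernels on
`ℓ²(Ω; ℝ^N)`, `Ω ⊂ ℤ^d` finite — the statement B4 typed as `Sect5ThmUniform` (a leaf of `LeafB4`).  Nothing else of Bałaban's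
series is asserted; K0⁷ `stmt-QuantumFields-20541` is OPEN; the Yang–Mills mass gap (Clay) is NOT proved by any of this.

Route (Dimock arXiv:1108.1335 App. D L.29–L.30 transplanted; cf. the seat's `Seat4CoerciveTransferSketch.lean` § Proofs):
§CT  abstract Combes–Thomas for coercive matrices (`combesThomasAbs_holds`);
§A   lattice sums `Σ_{y∈S} e^{−a|x−y|_∞} ≤ G(d,a)` uniformly in the finite set `S ⊂ ℤ^d` (product trick + geometric series);
§B   weighted Schur bound from the entry decay (5.6): `Σ_q |A p q|(e^{μ|p−q|} − 1) ≤ μ·K(c₀,δ₀,d,N)` for `μ ≤ δ₀∕2`;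
§C   coercivity of the compressions `A_Λ = ΛAΛ` (extension by zero);
§D   (5.7) with `c₁ = 2∕γ₀`, `δ₁ = μ*` uniform in `Ω, Λ, A` (`concl57_uniform`);
§E   (5.8) by the block identity `C_Λ − C_Ω = Σ_{r∈Λ, s∈Ω∖Λ} C_Λ(·,r)A(r,s)C_Ω(s,·)` (`deltaC_identity`, `concl58_uniform`);
§F   (5.10) by the resolvent identity `A_Λ⁻¹ − (A+B)_Λ⁻¹ = A_Λ⁻¹ B_Λ (A+B)_Λ⁻¹` (`resolvent_identity`, `concl510_uniform`);
§G   `sect5ThmUniform_holds : Sect5ThmUniform d N` (δ₁ = μ*∕4, c₁ = 2∕γ₀ + (2∕γ₀)²·c₀·(N·G(d,μ*∕2))²) and, by B4's own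
     `sect5_literal_of_uniform`, `sect5ThmLiteral_holds : Sect5ThmLiteral d N`.

STATUS 2026-08-30T19:52Z: `lean check --json` rc 0 · 0 errors · 0 warnings · 0 sorries; `#print axioms sect5ThmUniform_holds`
= [propext, Classical.choice, Quot.sound].  PORT NOTE (for a typer∕prover seat; this planner seat does not `ledger propose`):
the file is self-contained over `Mathlib` + `…Balaban1983to89.B4`; landing it as `Literature/…/Balaban1983to89/B4Sect5Proof.lean`
(or under `Summits/QuantumFields/YangMills/Theorems/`) turns the `Sect5ThmUniform d N` hypothesis of `LeafB4`∕`leafB4_of_literal`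
into a theorem — i.e. B4's unit-lattice propagator input to the B4→B9 response chain (PRINT-ROAD §3 ρ4, bottom rung) needs no leaf.
-/

noncomputable section
open Matrix Finset Real
open scoped BigOperators

namespace YM.NodeO.Seat4.B4Sect5

open Literature.MathematicalPhysics.QuantumFieldTheory.Balaban1983to89.B4

/-! ## §CT — abstract Combes–Thomas (copied from the seat's Sketch § Proofs; self-contained over Mathlib) -/

def conjW {ι : Type*} (μ : ℝ) (ρ : ι → ℝ) (H : Matrix ι ι ℝ) : Matrix ι ι ℝ :=
  Matrix.of fun i j => Real.exp (μ * ρ i) * H i j * Real.exp (-(μ * ρ j))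

def CombesThomasAbs : Prop :=
  ∀ (ι : Type) [Fintype ι] [DecidableEq ι] (H : Matrix ι ι ℝ) (d : ι → ι → ℝ) (m μ : ℝ),
    0 < m → 0 ≤ μ →
    (∀ i, d i i = 0) → (∀ i j, 0 ≤ d i j) → (∀ i j, d i j = d j i) → (∀ i j l, d i l ≤ d i j + d j l) →
    (∀ f : ι → ℝ, m * (f ⬝ᵥ f) ≤ f ⬝ᵥ (H *ᵥ f)) →
    (∀ i, ∑ j, |H i j| * (Real.exp (μ * d i j) - 1) ≤ m / 2) →
    (∀ j, ∑ i, |H i j| * (Real.exp (μ * d i j) - 1) ≤ m / 2) →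
    ∀ i j, |H⁻¹ i j| ≤ 2 / m * Real.exp (-(μ * d i j))


section CT
variable {ι : Type*} [Fintype ι] [DecidableEq ι]

omit [Fintype ι] [DecidableEq ι] in
theorem conjW_apply (μ : ℝ) (ρ : ι → ℝ) (H : Matrix ι ι ℝ) (i j : ι) :
    conjW μ ρ H i j = Real.exp (μ * ρ i) * H i j * Real.exp (-(μ * ρ j)) := rfl

theorem exp_neg_mul_exp (x : ℝ) : Real.exp (-x) * Real.exp x = 1 := by
  rw [← Real.exp_add, neg_add_cancel, Real.exp_zero]

theorem exp_mul_exp_neg (x : ℝ) : Real.exp x * Real.exp (-x) = 1 := by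
  rw [← Real.exp_add, add_neg_cancel, Real.exp_zero]

omit [DecidableEq ι] in
theorem conjW_mul (μ : ℝ) (ρ : ι → ℝ) (A B : Matrix ι ι ℝ) :
    conjW μ ρ (A * B) = conjW μ ρ A * conjW μ ρ B := by
  ext i j
  simp only [conjW_apply, Matrix.mul_apply]
  rw [Finset.mul_sum, Finset.sum_mul]
  refine Finset.sum_congr rfl fun l _ => ?_
  have h := exp_neg_mul_exp (μ * ρ l)
  calc Real.exp (μ * ρ i) * (A i l * B l j) * Real.exp (-(μ * ρ j))
      = Real.exp (μ * ρ i) * A i l * (Real.exp (-(μ * ρ l)) * Real.exp (μ * ρ l)) * B l j *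
          Real.exp (-(μ * ρ j)) := by rw [h]; ring
    _ = Real.exp (μ * ρ i) * A i l * Real.exp (-(μ * ρ l)) *
          (Real.exp (μ * ρ l) * B l j * Real.exp (-(μ * ρ j))) := by ring

omit [Fintype ι] in
theorem conjW_one (μ : ℝ) (ρ : ι → ℝ) : conjW μ ρ (1 : Matrix ι ι ℝ) = 1 := by
  ext i j
  rw [conjW_apply, Matrix.one_apply]
  split_ifs with h
  · subst h; rw [mul_one, exp_mul_exp_neg]
  · rw [mul_zero, zero_mul]

omit [DecidableEq ι] in
theorem dp_self_nonneg (v : ι → ℝ) : 0 ≤ v ⬝ᵥ v :=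
  Finset.sum_nonneg fun i _ => mul_self_nonneg (v i)

omit [DecidableEq ι] in
theorem sq_le_dp_self (v : ι → ℝ) (i : ι) : v i ^ 2 ≤ v ⬝ᵥ v := by
  unfold dotProduct
  have : v i ^ 2 = v i * v i := sq (v i)
  rw [this]
  exact Finset.single_le_sum (f := fun l => v l * v l) (fun l _ => mul_self_nonneg (v l)) (Finset.mem_univ i)

/-- A coercive real matrix is a unit. -/
theorem isUnit_of_coercive {A : Matrix ι ι ℝ} {c : ℝ} (hc : 0 < c)
    (hA : ∀ f : ι → ℝ, c * (f ⬝ᵥ f) ≤ f ⬝ᵥ (A *ᵥ f)) : IsUnit A := by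
  rw [← Matrix.mulVec_injective_iff_isUnit]
  have key : ∀ v : ι → ℝ, A *ᵥ v = 0 → v = 0 := by
    intro v hv
    have h1 := hA v
    rw [hv, dotProduct_zero] at h1
    have h0 := dp_self_nonneg v
    have h2 : v ⬝ᵥ v = 0 := by
      by_contra h
      have : 0 < v ⬝ᵥ v := lt_of_le_of_ne h0 (Ne.symm h)
      nlinarith
    exact dotProduct_self_eq_zero.mp h2
  intro f g hfg
  have : A *ᵥ (f - g) = 0 := by rw [Matrix.mulVec_sub, hfg, sub_self]
  exact sub_eq_zero.mp (key _ this)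

/-- Entries of the inverse of a coercive matrix are bounded by `1/c`. -/
theorem inv_entry_le_of_coercive {A : Matrix ι ι ℝ} {c : ℝ} (hc : 0 < c)
    (hA : ∀ f : ι → ℝ, c * (f ⬝ᵥ f) ≤ f ⬝ᵥ (A *ᵥ f)) (i j : ι) : |A⁻¹ i j| ≤ 1 / c := by
  have hU : IsUnit A := isUnit_of_coercive hc hA
  have hdet : IsUnit A.det := (Matrix.isUnit_iff_isUnit_det A).mp hU
  set v : ι → ℝ := fun l => A⁻¹ l j with hv
  have hv' : v = A⁻¹ *ᵥ Pi.single j 1 := by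
    ext l
    simp only [hv, Matrix.mulVec, dotProduct, Pi.single_apply, mul_ite, mul_one, mul_zero,
      Finset.sum_ite_eq', Finset.mem_univ, if_true]
  have hAv : A *ᵥ v = Pi.single j 1 := by
    rw [hv', Matrix.mulVec_mulVec, Matrix.mul_nonsing_inv A hdet, Matrix.one_mulVec]
  have h1 := hA v
  rw [hAv] at h1
  have h2 : v ⬝ᵥ Pi.single j (1 : ℝ) = v j := by
    simp only [dotProduct, Pi.single_apply, mul_ite, mul_one, mul_zero, Finset.sum_ite_eq',
      Finset.mem_univ, if_true]
  rw [h2] at h1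
  -- h1 : c * (v ⬝ᵥ v) ≤ v j ;  (c s)^2 ≤ (v j)^2 ≤ s  ⇒  s ≤ 1/c^2  ⇒ |v i| ≤ 1/c
  have hs0 := dp_self_nonneg v
  have hvj := sq_le_dp_self v j
  have hvi := sq_le_dp_self v i
  have hvi' : v i ^ 2 ≤ (1 / c) ^ 2 := by
    rcases eq_or_lt_of_le hs0 with h | h
    · rw [← h] at hvi
      have : v i ^ 2 = 0 := le_antisymm hvi (sq_nonneg _)
      rw [this]; positivity
    · have h3 : (c * (v ⬝ᵥ v)) ^ 2 ≤ v j ^ 2 :=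
        pow_le_pow_left₀ (by positivity) h1 2
      have h4 : c ^ 2 * (v ⬝ᵥ v) ≤ 1 := by nlinarith
      have h5 : v ⬝ᵥ v ≤ (1 / c) ^ 2 := by
        rw [div_pow, one_pow, le_div_iff₀ (by positivity)]; linarith [mul_comm (c^2) (v ⬝ᵥ v)]
      exact hvi.trans h5
  have hA' : A⁻¹ i j = v i := rfl
  rw [hA']
  exact abs_le_of_sq_le_sq (by simpa using hvi') (by positivity)

/-- **Core of the Combes–Thomas transfer.** If `H` is a unit and its exponential conjugate `H_μ = e^{μρ} H e^{−μρ}` is coercive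
with constant `c`, then `|H⁻¹ i j| ≤ c⁻¹ · e^{−μ(ρ i − ρ j)}`. -/
theorem ct_core (H : Matrix ι ι ℝ) (ρ : ι → ℝ) (μ c : ℝ) (hc : 0 < c) (hH : IsUnit H)
    (hcoμ : ∀ f : ι → ℝ, c * (f ⬝ᵥ f) ≤ f ⬝ᵥ (conjW μ ρ H *ᵥ f)) (i j : ι) :
    |H⁻¹ i j| ≤ 1 / c * Real.exp (-(μ * (ρ i - ρ j))) := by
  have hent : |(conjW μ ρ H)⁻¹ i j| ≤ 1 / c := inv_entry_le_of_coercive hc hcoμ i j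
  have hHdet : IsUnit H.det := (Matrix.isUnit_iff_isUnit_det H).mp hH
  have hinv : (conjW μ ρ H)⁻¹ = conjW μ ρ H⁻¹ := by
    apply Matrix.inv_eq_right_inv
    rw [← conjW_mul, Matrix.mul_nonsing_inv H hHdet, conjW_one]
  have hrel : H⁻¹ i j = Real.exp (-(μ * (ρ i - ρ j))) * (conjW μ ρ H)⁻¹ i j := by
    rw [hinv, conjW_apply, show -(μ * (ρ i - ρ j)) = -(μ * ρ i) + μ * ρ j by ring, Real.exp_add]
    have h1 := exp_neg_mul_exp (μ * ρ i)
    have h2 := exp_mul_exp_neg (μ * ρ j)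
    calc H⁻¹ i j = (Real.exp (-(μ * ρ i)) * Real.exp (μ * ρ i)) * H⁻¹ i j *
          (Real.exp (μ * ρ j) * Real.exp (-(μ * ρ j))) := by rw [h1, h2]; ring
      _ = _ := by ring
  rw [hrel, abs_mul, abs_of_pos (Real.exp_pos _), mul_comm]
  exact mul_le_mul_of_nonneg_right hent (Real.exp_pos _).le

/-- `|e^t − 1| ≤ e^{|t|} − 1`. -/
theorem abs_exp_sub_one_le (t : ℝ) : |Real.exp t - 1| ≤ Real.exp |t| - 1 := by
  rcases le_or_gt 0 t with h | h
  · rw [abs_of_nonneg h, abs_of_nonneg (by linarith [Real.one_le_exp h] : (0:ℝ) ≤ Real.exp t - 1)]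
  · rw [abs_of_neg h]
    have h1 : Real.exp t ≤ 1 := Real.exp_le_one_iff.mpr h.le
    rw [abs_of_nonpos (by linarith : Real.exp t - 1 ≤ 0)]
    have h2 := Real.add_one_le_exp t
    have h3 := Real.add_one_le_exp (-t)
    linarith

theorem combesThomasAbs_holds : CombesThomasAbs := by
  intro ι _ _ H d m μ hm hμ hd0 hdnn hdsy hdtr hco hrow hcol i j
  -- the weight ρ = d(·, j) and the conjugated matrix
  set ρ : ι → ℝ := fun l => d l j with hρ
  set Hμ : Matrix ι ι ℝ := conjW μ ρ H with hHμ
  set T : ι → ι → ℝ := fun a b => |H a b| * (Real.exp (μ * d a b) - 1) with hT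
  have hTnn : ∀ a b, 0 ≤ T a b := fun a b =>
    mul_nonneg (abs_nonneg _) (by have := Real.one_le_exp (mul_nonneg hμ (hdnn a b)); linarith)
  -- Step 1: entrywise defect bound
  have hdef : ∀ a b, |Hμ a b - H a b| ≤ T a b := by
    intro a b
    have hlip : |ρ a - ρ b| ≤ d a b := by
      simp only [hρ]
      rw [abs_le]; constructor
      · have := hdtr b a j; rw [hdsy b a] at this; linarith
      · have := hdtr a b j; linarith
    have e1 : Hμ a b - H a b = H a b * (Real.exp (μ * (ρ a - ρ b)) - 1) := by
      rw [hHμ, conjW_apply, show μ * (ρ a - ρ b) = μ * ρ a + -(μ * ρ b) by ring, Real.exp_add]; ring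
    rw [e1, abs_mul]
    refine mul_le_mul_of_nonneg_left ?_ (abs_nonneg _)
    have h2 := abs_exp_sub_one_le (μ * (ρ a - ρ b))
    have h3 : Real.exp |μ * (ρ a - ρ b)| ≤ Real.exp (μ * d a b) := by
      apply Real.exp_le_exp.mpr
      rw [abs_mul, abs_of_nonneg hμ]
      exact mul_le_mul_of_nonneg_left hlip hμ
    linarith
  -- Step 2: coercivity of Hμ with constant m/2
  have hco2 : ∀ f : ι → ℝ, m / 2 * (f ⬝ᵥ f) ≤ f ⬝ᵥ (Hμ *ᵥ f) := by
    intro f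
    have hsplit : f ⬝ᵥ (Hμ *ᵥ f) = f ⬝ᵥ (H *ᵥ f) + f ⬝ᵥ ((Hμ - H) *ᵥ f) := by
      rw [Matrix.sub_mulVec, dotProduct_sub]; ring
    have hD : |f ⬝ᵥ ((Hμ - H) *ᵥ f)| ≤ m / 2 * (f ⬝ᵥ f) := by
      have e : f ⬝ᵥ ((Hμ - H) *ᵥ f) = ∑ a, ∑ b, f a * ((Hμ - H) a b * f b) := by
        simp only [dotProduct, Matrix.mulVec, Finset.mul_sum]
      rw [e]
      calc |∑ a, ∑ b, f a * ((Hμ - H) a b * f b)|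
          ≤ ∑ a, ∑ b, |f a * ((Hμ - H) a b * f b)| := by
            refine (Finset.abs_sum_le_sum_abs _ _).trans ?_
            exact Finset.sum_le_sum fun a _ => Finset.abs_sum_le_sum_abs _ _
        _ ≤ ∑ a, ∑ b, T a b * ((f a) ^ 2 + (f b) ^ 2) / 2 := by
            refine Finset.sum_le_sum fun a _ => Finset.sum_le_sum fun b _ => ?_
            rw [abs_mul, abs_mul, Matrix.sub_apply]
            have h1 := hdef a b
            have h2 : |f a| * |f b| ≤ ((f a) ^ 2 + (f b) ^ 2) / 2 := by
              nlinarith [sq_nonneg (|f a| - |f b|), sq_abs (f a), sq_abs (f b), abs_nonneg (f a), abs_nonneg (f b)]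
            calc |f a| * (|Hμ a b - H a b| * |f b|) = |Hμ a b - H a b| * (|f a| * |f b|) := by ring
              _ ≤ T a b * (((f a) ^ 2 + (f b) ^ 2) / 2) :=
                  mul_le_mul h1 h2 (mul_nonneg (abs_nonneg _) (abs_nonneg _)) (hTnn a b)
              _ = T a b * ((f a) ^ 2 + (f b) ^ 2) / 2 := by ring
        _ = (∑ a, (f a) ^ 2 * ∑ b, T a b) / 2 + (∑ b, (f b) ^ 2 * ∑ a, T a b) / 2 := by
            have : ∀ a b, T a b * ((f a) ^ 2 + (f b) ^ 2) / 2 = T a b * (f a) ^ 2 / 2 + T a b * (f b) ^ 2 / 2 :=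
              fun a b => by ring
            simp only [this, Finset.sum_add_distrib]
            congr 1
            · rw [Finset.sum_div]
              refine Finset.sum_congr rfl fun a _ => ?_
              rw [Finset.mul_sum, Finset.sum_div]
              refine Finset.sum_congr rfl fun b _ => ?_
              ring
            · rw [Finset.sum_comm, Finset.sum_div]
              refine Finset.sum_congr rfl fun b _ => ?_
              rw [Finset.mul_sum, Finset.sum_div]
              refine Finset.sum_congr rfl fun a _ => ?_
              ring
        _ ≤ (∑ a, (f a) ^ 2 * (m / 2)) / 2 + (∑ b, (f b) ^ 2 * (m / 2)) / 2 := by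
            gcongr with a _ b _
            · exact hrow a
            · exact hcol b
        _ = m / 2 * (f ⬝ᵥ f) := by
            simp only [dotProduct, ← Finset.sum_mul, sq]
            ring
    have h0 := hco f
    have habs := neg_abs_le (f ⬝ᵥ ((Hμ - H) *ᵥ f))
    rw [hsplit]
    linarith
  -- Steps 3–4: the core lemma with c = m/2 and ρ = d(·, j), ρ j = d j j = 0
  have hHunit : IsUnit H := isUnit_of_coercive hm hco
  have key := ct_core H ρ μ (m / 2) (by positivity) hHunit hco2 i j
  have e1 : (1 : ℝ) / (m / 2) = 2 / m := by field_simp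
  have e2 : -(μ * (ρ i - ρ j)) = -(μ * d i j) := by simp only [hρ, hd0 j, sub_zero]
  rw [e1, e2] at key
  exact key

end CT

/-! ## §A — lattice sums in the sup-metric of `ℤ^d`, uniform in the finite index set -/

/-- 1-D geometric bound: `Σ_{m∈T} e^{−b|c−m|} ≤ 2∕(1 − e^{−b})` for every finite `T ⊂ ℤ`. [folklore] -/
theorem sum_exp_abs_le (b : ℝ) (hb : 0 < b) (T : Finset ℤ) (c : ℤ) :
    ∑ m ∈ T, Real.exp (-(b * |(c : ℝ) - m|)) ≤ 2 / (1 - Real.exp (-b)) := by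
  set r := Real.exp (-b) with hr
  have hr0 : 0 ≤ r := (Real.exp_pos _).le
  have hr1 : r < 1 := Real.exp_lt_one_iff.mpr (by linarith)
  have hterm : ∀ m : ℤ, Real.exp (-(b * |(c : ℝ) - m|)) = r ^ (c - m).natAbs := by
    intro m
    rw [hr, ← Real.exp_nat_mul]
    congr 1
    have : |(c : ℝ) - m| = ((c - m).natAbs : ℝ) := by
      rw [Nat.cast_natAbs]; push_cast; rfl
    rw [this]; ring
  have hsumm : Summable (fun n : ℕ => r ^ n) := summable_geometric_of_lt_one hr0 hr1
  have htsum : ∑' n : ℕ, r ^ n = (1 - r)⁻¹ := tsum_geometric_of_lt_one hr0 hr1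
  have hpart : ∀ (P : ℤ → Prop) [DecidablePred P],
      Set.InjOn (fun m : ℤ => (c - m).natAbs) (T.filter P : Set ℤ) →
      ∑ m ∈ T.filter P, r ^ (c - m).natAbs ≤ (1 - r)⁻¹ := by
    intro P _ hinj
    rw [← Finset.sum_image (f := fun n : ℕ => r ^ n) hinj, ← htsum]
    exact hsumm.sum_le_tsum _ (fun n _ => pow_nonneg hr0 n)
  have hinj1 : Set.InjOn (fun m : ℤ => (c - m).natAbs) (T.filter (fun m => c ≤ m) : Set ℤ) := by
    intro m hm m' hm' e
    simp only [Finset.coe_filter, Set.mem_setOf_eq] at hm hm'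
    have := Int.natAbs_eq_natAbs_iff.mp e
    omega
  have hinj2 : Set.InjOn (fun m : ℤ => (c - m).natAbs) (T.filter (fun m => ¬ c ≤ m) : Set ℤ) := by
    intro m hm m' hm' e
    simp only [Finset.coe_filter, Set.mem_setOf_eq] at hm hm'
    have := Int.natAbs_eq_natAbs_iff.mp e
    omega
  calc ∑ m ∈ T, Real.exp (-(b * |(c : ℝ) - m|))
      = ∑ m ∈ T, r ^ (c - m).natAbs := Finset.sum_congr rfl fun m _ => hterm m
    _ = ∑ m ∈ T.filter (fun m => c ≤ m), r ^ (c - m).natAbs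
          + ∑ m ∈ T.filter (fun m => ¬ c ≤ m), r ^ (c - m).natAbs :=
        (Finset.sum_filter_add_sum_filter_not T (fun m => c ≤ m) _).symm
    _ ≤ (1 - r)⁻¹ + (1 - r)⁻¹ := add_le_add (hpart _ hinj1) (hpart _ hinj2)
    _ = 2 / (1 - r) := by rw [div_eq_mul_inv]; ring

/-- The uniform lattice-sum constant `G(d,a) = (2∕(1 − e^{−a∕(d+1)}))^d`. [folklore] -/
def latG (d : ℕ) (a : ℝ) : ℝ := (2 / (1 - Real.exp (-(a / (d + 1))))) ^ d

theorem latG_nonneg (d : ℕ) (a : ℝ) (ha : 0 < a) : 0 ≤ latG d a := by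
  unfold latG
  apply pow_nonneg
  apply div_nonneg (by norm_num)
  have hq : (0:ℝ) < a / (d + 1) := by positivity
  have : Real.exp (-(a / (d + 1))) < 1 := Real.exp_lt_one_iff.mpr (by linarith)
  linarith

/-- `Σ_{y∈S} e^{−a·dist(x,y)} ≤ G(d,a)` for every finite `S ⊂ ℤ^d` and every `x ∈ ℤ^d` (sup-metric). [folklore] -/
theorem sum_exp_dist_le (d : ℕ) (a : ℝ) (ha : 0 < a) (S : Finset (Fin d → ℤ)) (x : Fin d → ℤ) :
    ∑ y ∈ S, Real.exp (-(a * dist x y)) ≤ latG d a := by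
  set b := a / (d + 1) with hb
  have hd1 : (0 : ℝ) < d + 1 := by positivity
  have hb0 : 0 < b := by positivity
  have hpt : ∀ y : Fin d → ℤ,
      Real.exp (-(a * dist x y)) ≤ ∏ i, Real.exp (-(b * |((x i : ℤ) : ℝ) - y i|)) := by
    intro y
    rw [← Real.exp_sum]
    apply Real.exp_le_exp.mpr
    have h1 : ∀ i, |((x i : ℤ) : ℝ) - y i| ≤ dist x y := fun i => by
      rw [← Int.dist_eq]; exact dist_le_pi_dist x y i
    have h2 : ∑ i : Fin d, |((x i : ℤ) : ℝ) - y i| ≤ (d + 1) * dist x y := by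
      calc ∑ i : Fin d, |((x i : ℤ) : ℝ) - y i| ≤ ∑ _i : Fin d, dist x y := Finset.sum_le_sum fun i _ => h1 i
        _ = d * dist x y := by simp
        _ ≤ (d + 1) * dist x y := by nlinarith [dist_nonneg (x := x) (y := y)]
    rw [Finset.sum_neg_distrib, neg_le_neg_iff, ← Finset.mul_sum]
    calc b * ∑ i, |((x i : ℤ) : ℝ) - y i| ≤ b * ((d + 1) * dist x y) := mul_le_mul_of_nonneg_left h2 hb0.le
      _ = a * dist x y := by rw [hb]; field_simp
  set t : Fin d → Finset ℤ := fun i => S.image (fun y => y i)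
  have hsub : S ⊆ Fintype.piFinset t := by
    intro y hy
    rw [Fintype.mem_piFinset]
    intro i; exact Finset.mem_image_of_mem _ hy
  calc ∑ y ∈ S, Real.exp (-(a * dist x y))
      ≤ ∑ y ∈ S, ∏ i, Real.exp (-(b * |((x i : ℤ) : ℝ) - y i|)) := Finset.sum_le_sum fun y _ => hpt y
    _ ≤ ∑ y ∈ Fintype.piFinset t, ∏ i, Real.exp (-(b * |((x i : ℤ) : ℝ) - y i|)) :=
        Finset.sum_le_sum_of_subset_of_nonneg hsub
          (fun y _ _ => Finset.prod_nonneg fun i _ => (Real.exp_pos _).le)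
    _ = ∏ i, ∑ m ∈ t i, Real.exp (-(b * |((x i : ℤ) : ℝ) - m|)) :=
        (Finset.prod_univ_sum t (fun i m => Real.exp (-(b * |((x i : ℤ) : ℝ) - m|)))).symm
    _ ≤ ∏ _i : Fin d, (2 / (1 - Real.exp (-b))) := by
        apply Finset.prod_le_prod
        · intro i _; exact Finset.sum_nonneg fun m _ => (Real.exp_pos _).le
        · intro i _; exact sum_exp_abs_le b hb0 (t i) (x i)
    _ = latG d a := by rw [Finset.prod_const, Finset.card_univ, Fintype.card_fin, hb]; rfl

/-- The same sum over the index set `Idx Λ N = Λ × Fin N` of `ℓ²(Λ; ℝ^N)`. [folklore] -/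
theorem sum_idx_exp_le {d N : ℕ} (a : ℝ) (ha : 0 < a) (Λ : Finset (Fin d → ℤ)) (x : Fin d → ℤ) :
    ∑ q : Idx Λ N, Real.exp (-(a * dist x (q.1 : Fin d → ℤ))) ≤ N * latG d a := by
  rw [Fintype.sum_prod_type]
  simp only [Finset.sum_const, Finset.card_univ, Fintype.card_fin, nsmul_eq_mul]
  rw [← Finset.mul_sum, Finset.sum_coe_sort Λ (fun y => Real.exp (-(a * dist x y)))]
  exact mul_le_mul_of_nonneg_left (sum_exp_dist_le d a ha Λ x) (Nat.cast_nonneg N)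

/-! ## §B — the weighted Schur bound from the entry decay of (5.6) -/

/-- `e^s − 1 ≤ s·e^s`. [folklore] -/
theorem exp_sub_one_le_mul_exp (s : ℝ) : Real.exp s - 1 ≤ s * Real.exp s := by
  have h := Real.add_one_le_exp (-s)
  have hpos := Real.exp_pos s
  have : (-s + 1) * Real.exp s ≤ Real.exp (-s) * Real.exp s := mul_le_mul_of_nonneg_right h hpos.le
  rw [← Real.exp_add, neg_add_cancel, Real.exp_zero] at this
  nlinarith

/-- `t·e^{−κt} ≤ κ⁻¹` for `t ≥ 0`, `κ > 0`. [folklore] -/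
theorem mul_exp_neg_le (t κ : ℝ) (_ht : 0 ≤ t) (hκ : 0 < κ) : t * Real.exp (-(κ * t)) ≤ 1 / κ := by
  have h := Real.add_one_le_exp (κ * t)
  have hpos := Real.exp_pos (-(κ * t))
  have e : Real.exp (κ * t) * Real.exp (-(κ * t)) = 1 := by rw [← Real.exp_add, add_neg_cancel, Real.exp_zero]
  have h1 : κ * t * Real.exp (-(κ * t)) ≤ 1 := by
    calc κ * t * Real.exp (-(κ * t)) ≤ (κ * t + 1) * Real.exp (-(κ * t)) := by
          apply mul_le_mul_of_nonneg_right (by linarith) hpos.le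
      _ ≤ Real.exp (κ * t) * Real.exp (-(κ * t)) := mul_le_mul_of_nonneg_right h hpos.le
      _ = 1 := e
  rw [le_div_iff₀ hκ]
  linarith [mul_comm κ (t * Real.exp (-(κ * t)))]

/-- Pointwise: `e^{−δ₀t}(e^{μt} − 1) ≤ μ·(4∕δ₀)·e^{−(δ₀∕4)t}` for `t ≥ 0`, `0 ≤ μ ≤ δ₀∕2`. [folklore] -/
theorem decay_weight_pt (t δ₀ μ : ℝ) (ht : 0 ≤ t) (hδ : 0 < δ₀) (hμ0 : 0 ≤ μ) (hμ : μ ≤ δ₀ / 2) :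
    Real.exp (-(δ₀ * t)) * (Real.exp (μ * t) - 1) ≤ μ * (4 / δ₀) * Real.exp (-(δ₀ / 4 * t)) := by
  have h1 : Real.exp (μ * t) - 1 ≤ μ * t * Real.exp (μ * t) := by
    have := exp_sub_one_le_mul_exp (μ * t); linarith
  have h2 : Real.exp (-(δ₀ * t)) * Real.exp (μ * t) ≤ Real.exp (-(δ₀ / 2 * t)) := by
    rw [← Real.exp_add]; apply Real.exp_le_exp.mpr; nlinarith
  have h3 : t * Real.exp (-(δ₀ / 4 * t)) ≤ 1 / (δ₀ / 4) := mul_exp_neg_le t (δ₀ / 4) ht (by positivity)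
  have e4 : Real.exp (-(δ₀ / 2 * t)) = Real.exp (-(δ₀ / 4 * t)) * Real.exp (-(δ₀ / 4 * t)) := by
    rw [← Real.exp_add]; congr 1; ring
  have hE := Real.exp_pos (-(δ₀ / 4 * t))
  calc Real.exp (-(δ₀ * t)) * (Real.exp (μ * t) - 1)
      ≤ Real.exp (-(δ₀ * t)) * (μ * t * Real.exp (μ * t)) :=
        mul_le_mul_of_nonneg_left h1 (Real.exp_pos _).le
    _ = μ * t * (Real.exp (-(δ₀ * t)) * Real.exp (μ * t)) := by ring
    _ ≤ μ * t * Real.exp (-(δ₀ / 2 * t)) := mul_le_mul_of_nonneg_left h2 (by positivity)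
    _ = μ * (t * Real.exp (-(δ₀ / 4 * t))) * Real.exp (-(δ₀ / 4 * t)) := by rw [e4]; ring
    _ ≤ μ * (1 / (δ₀ / 4)) * Real.exp (-(δ₀ / 4 * t)) := by
        apply mul_le_mul_of_nonneg_right _ hE.le
        exact mul_le_mul_of_nonneg_left h3 hμ0
    _ = μ * (4 / δ₀) * Real.exp (-(δ₀ / 4 * t)) := by
        congr 1; rw [one_div_div]

/-- The Schur constant `K = c₀·(4∕δ₀)·N·G(d, δ₀∕4)`. [folklore] -/
def schurK (d N : ℕ) (c₀ δ₀ : ℝ) : ℝ := c₀ * (4 / δ₀) * (N * latG d (δ₀ / 4))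

theorem schurK_nonneg (d N : ℕ) (c₀ δ₀ : ℝ) (hc : 0 ≤ c₀) (hδ : 0 < δ₀) : 0 ≤ schurK d N c₀ δ₀ := by
  unfold schurK
  have := latG_nonneg d (δ₀ / 4) (by positivity)
  positivity

/-- Weighted Schur ROW bound from entry decay, uniform in the finite volume. [folklore] -/
theorem schur_of_decay {d N : ℕ} {Λ : Finset (Fin d → ℤ)} (F : Idx Λ N → Idx Λ N → ℝ) (c₀ δ₀ μ : ℝ)
    (hc₀ : 0 ≤ c₀) (hδ₀ : 0 < δ₀) (hμ0 : 0 ≤ μ) (hμ : μ ≤ δ₀ / 2)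
    (hF : ∀ p q : Idx Λ N, |F p q| ≤ c₀ * Real.exp (-(δ₀ * dist (p.1 : Fin d → ℤ) (q.1 : Fin d → ℤ))))
    (p : Idx Λ N) :
    ∑ q, |F p q| * (Real.exp (μ * dist (p.1 : Fin d → ℤ) (q.1 : Fin d → ℤ)) - 1) ≤ μ * schurK d N c₀ δ₀ := by
  have hpt : ∀ q : Idx Λ N, |F p q| * (Real.exp (μ * dist (p.1 : Fin d → ℤ) (q.1 : Fin d → ℤ)) - 1)
      ≤ μ * (c₀ * (4 / δ₀)) * Real.exp (-(δ₀ / 4 * dist (p.1 : Fin d → ℤ) (q.1 : Fin d → ℤ))) := by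
    intro q
    set t := dist (p.1 : Fin d → ℤ) (q.1 : Fin d → ℤ)
    have ht : 0 ≤ t := dist_nonneg
    have hw : 0 ≤ Real.exp (μ * t) - 1 := by
      have := Real.one_le_exp (mul_nonneg hμ0 ht); linarith
    calc |F p q| * (Real.exp (μ * t) - 1) ≤ c₀ * Real.exp (-(δ₀ * t)) * (Real.exp (μ * t) - 1) :=
          mul_le_mul_of_nonneg_right (hF p q) hw
      _ = c₀ * (Real.exp (-(δ₀ * t)) * (Real.exp (μ * t) - 1)) := by ring
      _ ≤ c₀ * (μ * (4 / δ₀) * Real.exp (-(δ₀ / 4 * t))) :=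
          mul_le_mul_of_nonneg_left (decay_weight_pt t δ₀ μ ht hδ₀ hμ0 hμ) hc₀
      _ = μ * (c₀ * (4 / δ₀)) * Real.exp (-(δ₀ / 4 * t)) := by ring
  calc ∑ q, |F p q| * (Real.exp (μ * dist (p.1 : Fin d → ℤ) (q.1 : Fin d → ℤ)) - 1)
      ≤ ∑ q : Idx Λ N, μ * (c₀ * (4 / δ₀)) * Real.exp (-(δ₀ / 4 * dist (p.1 : Fin d → ℤ) (q.1 : Fin d → ℤ))) :=
        Finset.sum_le_sum fun q _ => hpt q
    _ = μ * (c₀ * (4 / δ₀)) * ∑ q : Idx Λ N, Real.exp (-(δ₀ / 4 * dist (p.1 : Fin d → ℤ) (q.1 : Fin d → ℤ))) := by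
        rw [Finset.mul_sum]
    _ ≤ μ * (c₀ * (4 / δ₀)) * (N * latG d (δ₀ / 4)) := by
        apply mul_le_mul_of_nonneg_left (sum_idx_exp_le (δ₀ / 4) (by positivity) Λ _) (by positivity)
    _ = μ * schurK d N c₀ δ₀ := by unfold schurK; ring

/-! ## §C — coercivity of the compressions `A_Λ = ΛAΛ` -/

section Compress
variable {d N : ℕ} {Ω Λ : Finset (Fin d → ℤ)}

theorem inclIdx_injective (h : Λ ⊆ Ω) : Function.Injective (inclIdx (N := N) h) := by
  intro r r' e
  simp only [inclIdx, Prod.mk.injEq, Subtype.mk.injEq] at e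
  exact Prod.ext (Subtype.ext e.1) e.2

/-- Extension by zero from `ℓ²(Λ)` to `ℓ²(Ω)`. [folklore] -/
def ext0 (h : Λ ⊆ Ω) (w : Idx Λ N → ℝ) : Idx Ω N → ℝ :=
  fun p => ∑ r, if inclIdx h r = p then w r else 0

theorem sum_ext0_mul (h : Λ ⊆ Ω) (w : Idx Λ N → ℝ) (g : Idx Ω N → ℝ) :
    ∑ p, ext0 h w p * g p = ∑ r, w r * g (inclIdx h r) := by
  simp only [ext0, Finset.sum_mul]
  rw [Finset.sum_comm]
  refine Finset.sum_congr rfl fun r _ => ?_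
  simp only [ite_mul, zero_mul, Finset.sum_ite_eq, Finset.mem_univ, if_true]

theorem sum_mul_ext0 (h : Λ ⊆ Ω) (w : Idx Λ N → ℝ) (g : Idx Ω N → ℝ) :
    ∑ p, g p * ext0 h w p = ∑ r, g (inclIdx h r) * w r := by
  have := sum_ext0_mul h w g
  simpa only [mul_comm] using this

theorem ext0_incl (h : Λ ⊆ Ω) (w : Idx Λ N → ℝ) (r : Idx Λ N) : ext0 h w (inclIdx h r) = w r := by
  simp only [ext0]
  rw [Finset.sum_eq_single r]
  · rw [if_pos rfl]
  · intro r' _ hne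
    rw [if_neg]
    exact fun e => hne (inclIdx_injective h e)
  · intro hr; exact absurd (Finset.mem_univ r) hr

/-- Coercivity passes to the compression. [folklore] -/
theorem coercive_compress (h : Λ ⊆ Ω) (A : Matrix (Idx Ω N) (Idx Ω N) ℝ) (γ₀ : ℝ)
    (hco : ∀ v : Idx Ω N → ℝ, γ₀ * ∑ p, v p ^ 2 ≤ ∑ p, v p * A.mulVec v p) :
    ∀ w : Idx Λ N → ℝ, γ₀ * (w ⬝ᵥ w) ≤ w ⬝ᵥ (compress h A *ᵥ w) := by
  intro w
  have h1 := hco (ext0 h w)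
  have e1 : ∑ p, ext0 h w p ^ 2 = w ⬝ᵥ w := by
    simp only [sq]
    rw [sum_ext0_mul h w (ext0 h w)]
    simp only [ext0_incl, dotProduct]
  have e2 : ∑ p, ext0 h w p * A.mulVec (ext0 h w) p = w ⬝ᵥ (compress h A *ᵥ w) := by
    rw [sum_ext0_mul h w]
    simp only [dotProduct, Matrix.mulVec, compress, Matrix.submatrix_apply]
    refine Finset.sum_congr rfl fun r _ => ?_
    congr 1
    exact sum_mul_ext0 h w (fun q => A (inclIdx h r) q)
  rw [e1, e2] at h1
  exact h1

/-- Entries and site-distances of the compression are those of `A`. [folklore] -/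
theorem compress_apply (h : Λ ⊆ Ω) (A : Matrix (Idx Ω N) (Idx Ω N) ℝ) (p q : Idx Λ N) :
    compress h A p q = A (inclIdx h p) (inclIdx h q) := rfl

theorem coe_inclIdx (h : Λ ⊆ Ω) (p : Idx Λ N) : ((inclIdx h p).1 : Fin d → ℤ) = (p.1 : Fin d → ℤ) := rfl

end Compress

/-! ## §D — (5.7), uniform: decay of `A_Λ⁻¹` from (5.6) by Combes–Thomas -/

/-- The rate `μ* = min(δ₀∕2, γ₀∕(2(K+1)))`. [folklore] -/
def muStar (d N : ℕ) (γ₀ c₀ δ₀ : ℝ) : ℝ := min (δ₀ / 2) (γ₀ / (2 * (schurK d N c₀ δ₀ + 1)))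

theorem muStar_pos (d N : ℕ) (γ₀ c₀ δ₀ : ℝ) (hγ : 0 < γ₀) (hc : 0 ≤ c₀) (hδ : 0 < δ₀) : 0 < muStar d N γ₀ c₀ δ₀ := by
  unfold muStar
  have := schurK_nonneg d N c₀ δ₀ hc hδ
  apply lt_min (by positivity) (by positivity)

theorem muStar_le (d N : ℕ) (γ₀ c₀ δ₀ : ℝ) : muStar d N γ₀ c₀ δ₀ ≤ δ₀ / 2 := min_le_left _ _

theorem muStar_schur (d N : ℕ) (γ₀ c₀ δ₀ : ℝ) (hγ : 0 < γ₀) (hc : 0 ≤ c₀) (hδ : 0 < δ₀) :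
    muStar d N γ₀ c₀ δ₀ * schurK d N c₀ δ₀ ≤ γ₀ / 2 := by
  have hK := schurK_nonneg d N c₀ δ₀ hc hδ
  have h1 : muStar d N γ₀ c₀ δ₀ ≤ γ₀ / (2 * (schurK d N c₀ δ₀ + 1)) := min_le_right _ _
  have hμ0 := (muStar_pos d N γ₀ c₀ δ₀ hγ hc hδ).le
  calc muStar d N γ₀ c₀ δ₀ * schurK d N c₀ δ₀ ≤ γ₀ / (2 * (schurK d N c₀ δ₀ + 1)) * schurK d N c₀ δ₀ :=
        mul_le_mul_of_nonneg_right h1 hK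
    _ ≤ γ₀ / (2 * (schurK d N c₀ δ₀ + 1)) * (schurK d N c₀ δ₀ + 1) :=
        mul_le_mul_of_nonneg_left (by linarith) (by positivity)
    _ = γ₀ / 2 := by field_simp

/-- **(5.7), uniform reading, by Combes–Thomas.**  For `(γ₀, c₀, δ₀)` there is `μ* > 0` such that for EVERY finite
`Ω ⊂ ℤ^d`, every kernel `A` with (5.6), every `Λ ⊆ Ω`: `|A_Λ⁻¹(p,q)| ≤ (2∕γ₀)·e^{−μ*|p−q|}`.
[cite: Balaban1983RegularityDecay, Sect. 5 Theorem (5.7) p.594 — proof here NOT the print's (random walk pp.594–597) but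
coercivity + exponential conjugation, arXiv:1108.1335 Lemma 30] -/
theorem concl57_uniform (d N : ℕ) (γ₀ c₀ δ₀ : ℝ) (hγ : 0 < γ₀) (hc : 0 < c₀) (hδ : 0 < δ₀)
    (Ω : Finset (Fin d → ℤ)) (A : Matrix (Idx Ω N) (Idx Ω N) ℝ) (hA : Hyp56 Ω A γ₀ c₀ δ₀)
    (Λ : Finset (Fin d → ℤ)) (h : Λ ⊆ Ω) (p q : Idx Λ N) :
    |(compress h A)⁻¹ p q| ≤ 2 / γ₀ * Real.exp (-(muStar d N γ₀ c₀ δ₀ * dist (p.1 : Fin d → ℤ) (q.1 : Fin d → ℤ))) := by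
  set μ := muStar d N γ₀ c₀ δ₀ with hμdef
  have hμ0 : 0 < μ := muStar_pos d N γ₀ c₀ δ₀ hγ hc.le hδ
  have hμle : μ ≤ δ₀ / 2 := muStar_le d N γ₀ c₀ δ₀
  have hμK : μ * schurK d N c₀ δ₀ ≤ γ₀ / 2 := muStar_schur d N γ₀ c₀ δ₀ hγ hc.le hδ
  set H := compress h A with hH
  -- entry decay of H
  have hHF : ∀ p q : Idx Λ N, |H p q| ≤ c₀ * Real.exp (-(δ₀ * dist (p.1 : Fin d → ℤ) (q.1 : Fin d → ℤ))) := by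
    intro p q
    rw [hH, compress_apply]
    have := hA.2.2 (inclIdx h p) (inclIdx h q)
    simpa only [coe_inclIdx] using this
  have hHFt : ∀ p q : Idx Λ N, |H q p| ≤ c₀ * Real.exp (-(δ₀ * dist (p.1 : Fin d → ℤ) (q.1 : Fin d → ℤ))) := by
    intro p q; rw [dist_comm]; exact hHF q p
  -- Combes–Thomas hypotheses
  have hrow : ∀ i : Idx Λ N, ∑ j, |H i j| * (Real.exp (μ * dist (i.1 : Fin d → ℤ) (j.1 : Fin d → ℤ)) - 1) ≤ γ₀ / 2 :=
    fun i => (schur_of_decay (fun p q => H p q) c₀ δ₀ μ hc.le hδ hμ0.le hμle hHF i).trans hμK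
  have hcol : ∀ j : Idx Λ N, ∑ i, |H i j| * (Real.exp (μ * dist (i.1 : Fin d → ℤ) (j.1 : Fin d → ℤ)) - 1) ≤ γ₀ / 2 := by
    intro j
    have := (schur_of_decay (fun p q => H q p) c₀ δ₀ μ hc.le hδ hμ0.le hμle hHFt j).trans hμK
    refine le_trans (le_of_eq ?_) this
    refine Finset.sum_congr rfl fun i _ => ?_
    rw [dist_comm]
  have hcoer : ∀ f : Idx Λ N → ℝ, γ₀ * (f ⬝ᵥ f) ≤ f ⬝ᵥ (H *ᵥ f) := coercive_compress h A γ₀ hA.2.1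
  exact combesThomasAbs_holds (Idx Λ N) H (fun i j => dist (i.1 : Fin d → ℤ) (j.1 : Fin d → ℤ)) γ₀ μ hγ hμ0.le
    (fun i => dist_self _) (fun i j => dist_nonneg) (fun i j => dist_comm _ _) (fun i j l => dist_triangle _ _ _)
    hcoer hrow hcol p q


/-! ## §E — (5.8): `δC_Λ = C_Λ − C_Ω` by the block identity, and §F — (5.10) by the resolvent identity -/

section Stage2
variable {d N : ℕ}

/-- Site distance between indices of possibly different volumes. [folklore] -/
abbrev sd {Λ₁ Λ₂ : Finset (Fin d → ℤ)} (p : Idx Λ₁ N) (q : Idx Λ₂ N) : ℝ :=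
  dist (p.1 : Fin d → ℤ) (q.1 : Fin d → ℤ)

theorem compress_refl (Ω : Finset (Fin d → ℤ)) (A : Matrix (Idx Ω N) (Idx Ω N) ℝ) :
    compress (Finset.Subset.refl Ω) A = A := by
  ext p q; rfl

theorem compress_add {Ω Λ : Finset (Fin d → ℤ)} (h : Λ ⊆ Ω) (A B : Matrix (Idx Ω N) (Idx Ω N) ℝ) :
    compress h (A + B) = compress h A + compress h B := rfl

theorem isUnit_det_compress {Ω Λ : Finset (Fin d → ℤ)} (h : Λ ⊆ Ω) (A : Matrix (Idx Ω N) (Idx Ω N) ℝ)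
    (γ₀ : ℝ) (hγ : 0 < γ₀) (hco : ∀ v : Idx Ω N → ℝ, γ₀ * ∑ p, v p ^ 2 ≤ ∑ p, v p * A.mulVec v p) :
    IsUnit (compress h A).det :=
  (Matrix.isUnit_iff_isUnit_det _).mp (isUnit_of_coercive hγ (coercive_compress h A γ₀ hco))

/-- (5.7) for the full volume `Λ = Ω`. [folklore] -/
theorem concl57_full (γ₀ c₀ δ₀ : ℝ) (hγ : 0 < γ₀) (hc : 0 < c₀) (hδ : 0 < δ₀)
    (Ω : Finset (Fin d → ℤ)) (A : Matrix (Idx Ω N) (Idx Ω N) ℝ) (hA : Hyp56 Ω A γ₀ c₀ δ₀) (s s' : Idx Ω N) :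
    |A⁻¹ s s'| ≤ 2 / γ₀ * Real.exp (-(muStar d N γ₀ c₀ δ₀ * sd s s')) := by
  have := concl57_uniform d N γ₀ c₀ δ₀ hγ hc hδ Ω A hA Ω (Finset.Subset.refl Ω) s s'
  rwa [compress_refl] at this

/-- Splitting a sum over `Idx Ω N` into the image of `Idx Λ N` and the indices over `Ω ∖ Λ`. [folklore] -/
theorem sum_split {Ω Λ : Finset (Fin d → ℤ)} (h : Λ ⊆ Ω) (f : Idx Ω N → ℝ) :
    ∑ s, f s = ∑ r : Idx Λ N, f (inclIdx h r)
      + ∑ s ∈ Finset.univ.filter (fun s : Idx Ω N => (s.1 : Fin d → ℤ) ∉ Λ), f s := by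
  rw [← Finset.sum_filter_add_sum_filter_not Finset.univ (fun s : Idx Ω N => (s.1 : Fin d → ℤ) ∈ Λ)]
  congr 1
  have hset : Finset.univ.filter (fun s : Idx Ω N => (s.1 : Fin d → ℤ) ∈ Λ)
      = Finset.univ.image (inclIdx (N := N) h) := by
    ext s
    simp only [Finset.mem_filter, Finset.mem_univ, true_and, Finset.mem_image]
    constructor
    · intro hs
      exact ⟨(⟨(s.1 : Fin d → ℤ), hs⟩, s.2), Prod.ext (Subtype.ext rfl) rfl⟩
    · rintro ⟨r, rfl⟩
      exact r.1.2
  rw [hset, Finset.sum_image (fun r _ r' _ e => inclIdx_injective h e)]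

/-- The block identity behind (5.8): `C_Λ(p,q) − C_Ω(p,q) = Σ_{r∈Λ} Σ_{s∈Ω∖Λ} C_Λ(p,r)A(r,s)C_Ω(s,q)`. [folklore] -/
theorem deltaC_identity {Ω Λ : Finset (Fin d → ℤ)} (h : Λ ⊆ Ω) (A : Matrix (Idx Ω N) (Idx Ω N) ℝ)
    (hX : IsUnit (compress h A).det) (hY : IsUnit A.det) (p q : Idx Λ N) :
    (compress h A)⁻¹ p q - A⁻¹ (inclIdx h p) (inclIdx h q)
      = ∑ r : Idx Λ N, ∑ s ∈ Finset.univ.filter (fun s : Idx Ω N => (s.1 : Fin d → ℤ) ∉ Λ),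
          (compress h A)⁻¹ p r * A (inclIdx h r) s * A⁻¹ s (inclIdx h q) := by
  set X := (compress h A)⁻¹ with hXdef
  set Y := A⁻¹ with hYdef
  have hXA : X * compress h A = 1 := Matrix.nonsing_inv_mul _ hX
  have hAY : A * Y = 1 := Matrix.mul_nonsing_inv _ hY
  have ha : ∀ r : Idx Λ N, ∑ s, A (inclIdx h r) s * Y s (inclIdx h q) = if r = q then 1 else 0 := by
    intro r
    have e := congr_fun (congr_fun hAY (inclIdx h r)) (inclIdx h q)
    rw [Matrix.mul_apply, Matrix.one_apply] at e
    rw [e]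
    by_cases hrq : r = q
    · subst hrq; simp
    · rw [if_neg hrq, if_neg (fun e' => hrq (inclIdx_injective h e'))]
  have hb : ∀ r' : Idx Λ N, ∑ r, X p r * compress h A r r' = if p = r' then 1 else 0 := by
    intro r'
    have e := congr_fun (congr_fun hXA p) r'
    rw [Matrix.mul_apply, Matrix.one_apply] at e
    exact e
  have hXpq : X p q = ∑ r, X p r * ∑ s, A (inclIdx h r) s * Y s (inclIdx h q) := by
    simp only [ha, mul_ite, mul_one, mul_zero, Finset.sum_ite_eq', Finset.mem_univ, if_true]
  have hfirst : ∑ r, X p r * ∑ r', A (inclIdx h r) (inclIdx h r') * Y (inclIdx h r') (inclIdx h q)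
      = Y (inclIdx h p) (inclIdx h q) := by
    calc ∑ r, X p r * ∑ r', A (inclIdx h r) (inclIdx h r') * Y (inclIdx h r') (inclIdx h q)
        = ∑ r', (∑ r, X p r * compress h A r r') * Y (inclIdx h r') (inclIdx h q) := by
          simp only [Finset.mul_sum, Finset.sum_mul, compress_apply]
          rw [Finset.sum_comm]
          exact Finset.sum_congr rfl fun r' _ => Finset.sum_congr rfl fun r _ => by ring
      _ = Y (inclIdx h p) (inclIdx h q) := by
          simp only [hb, ite_mul, one_mul, zero_mul, Finset.sum_ite_eq, Finset.mem_univ, if_true]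
  have step : X p q = Y (inclIdx h p) (inclIdx h q)
      + ∑ r, X p r * ∑ s ∈ Finset.univ.filter (fun s : Idx Ω N => (s.1 : Fin d → ℤ) ∉ Λ),
          A (inclIdx h r) s * Y s (inclIdx h q) := by
    rw [hXpq, ← hfirst, ← Finset.sum_add_distrib]
    refine Finset.sum_congr rfl fun r _ => ?_
    have hs := sum_split h (fun s => A (inclIdx h r) s * Y s (inclIdx h q))
    rw [hs, mul_add]
  rw [step, add_sub_cancel_left]
  refine Finset.sum_congr rfl fun r _ => ?_
  rw [Finset.mul_sum]
  exact Finset.sum_congr rfl fun s _ => by ring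

/-- The resolvent identity behind (5.10): `A_Λ⁻¹ − (A+B)_Λ⁻¹ = A_Λ⁻¹ B_Λ (A+B)_Λ⁻¹`. [folklore] -/
theorem resolvent_identity {Ω Λ : Finset (Fin d → ℤ)} (h : Λ ⊆ Ω) (A B : Matrix (Idx Ω N) (Idx Ω N) ℝ)
    (hX : IsUnit (compress h A).det) (hZ : IsUnit (compress h (A + B)).det) :
    (compress h A)⁻¹ - (compress h (A + B))⁻¹
      = (compress h A)⁻¹ * compress h B * (compress h (A + B))⁻¹ := by
  set X := (compress h A)⁻¹
  set Z := (compress h (A + B))⁻¹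
  have h1 : X * compress h A = 1 := Matrix.nonsing_inv_mul _ hX
  have h2 : compress h (A + B) * Z = 1 := Matrix.mul_nonsing_inv _ hZ
  calc X - Z = X * (compress h (A + B) * Z) - (X * compress h A) * Z := by
        rw [h2, h1, Matrix.mul_one, Matrix.one_mul]
    _ = X * compress h B * Z := by
        rw [compress_add, Matrix.add_mul, Matrix.mul_add]
        simp only [Matrix.mul_assoc]
        abel

/-- Three-factor pointwise bound shared by (5.8) and (5.10). [folklore] -/
theorem triple_le (x a y c c₀ μ δ₀ t₁ t₂ t₃ e D : ℝ) (hc : 0 ≤ c) (hc₀ : 0 ≤ c₀) (hμ0 : 0 ≤ μ) (hμδ : μ ≤ δ₀)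
    (_ht₁ : 0 ≤ t₁) (_ht₂ : 0 ≤ t₂) (ht₃ : 0 ≤ t₃) (he : 0 ≤ e)
    (hx : |x| ≤ c * Real.exp (-(μ * t₁))) (ha : |a| ≤ c₀ * Real.exp (-(δ₀ * (t₂ + e))))
    (hy : |y| ≤ c * Real.exp (-(μ * t₃))) (hD : D ≤ 2 * (t₁ + t₂ + e + t₃)) :
    |x * a * y| ≤ c ^ 2 * c₀ * Real.exp (-(μ / 4 * D)) * (Real.exp (-(μ / 2 * t₁)) * Real.exp (-(μ / 2 * t₂))) := by
  rw [abs_mul, abs_mul]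
  have e1 : |x| * |a| * |y| ≤ (c * Real.exp (-(μ * t₁))) * (c₀ * Real.exp (-(δ₀ * (t₂ + e))))
      * (c * Real.exp (-(μ * t₃))) :=
    mul_le_mul (mul_le_mul hx ha (abs_nonneg _) (by positivity)) hy (abs_nonneg _) (by positivity)
  have e2 : Real.exp (-(δ₀ * (t₂ + e))) ≤ Real.exp (-(μ * (t₂ + e))) := Real.exp_le_exp.mpr (by nlinarith)
  have e3 : Real.exp (-(μ * t₁)) * Real.exp (-(μ * (t₂ + e))) * Real.exp (-(μ * t₃))
      ≤ Real.exp (-(μ / 4 * D)) * (Real.exp (-(μ / 2 * t₁)) * Real.exp (-(μ / 2 * t₂))) := by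
    rw [← Real.exp_add, ← Real.exp_add, ← Real.exp_add, ← Real.exp_add]
    apply Real.exp_le_exp.mpr
    nlinarith
  calc |x| * |a| * |y| ≤ _ := e1
    _ = c ^ 2 * c₀ * (Real.exp (-(μ * t₁)) * Real.exp (-(δ₀ * (t₂ + e))) * Real.exp (-(μ * t₃))) := by ring
    _ ≤ c ^ 2 * c₀ * (Real.exp (-(μ * t₁)) * Real.exp (-(μ * (t₂ + e))) * Real.exp (-(μ * t₃))) := by
        apply mul_le_mul_of_nonneg_left _ (by positivity)
        apply mul_le_mul_of_nonneg_right _ (Real.exp_pos _).le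
        exact mul_le_mul_of_nonneg_left e2 (Real.exp_pos _).le
    _ ≤ c ^ 2 * c₀ * (Real.exp (-(μ / 4 * D)) * (Real.exp (-(μ / 2 * t₁)) * Real.exp (-(μ / 2 * t₂)))) :=
        mul_le_mul_of_nonneg_left e3 (by positivity)
    _ = _ := by ring

/-- Double lattice sum bound. [folklore] -/
theorem double_sum_le (a : ℝ) (ha : 0 < a) {Λ₁ Λ₂ : Finset (Fin d → ℤ)} (x : Fin d → ℤ)
    (T : Finset (Idx Λ₂ N)) :
    ∑ r : Idx Λ₁ N, (Real.exp (-(a * dist x (r.1 : Fin d → ℤ))) * ∑ s ∈ T, Real.exp (-(a * sd r s)))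
      ≤ (N * latG d a) * (N * latG d a) := by
  have hG : 0 ≤ (N : ℝ) * latG d a := by have := latG_nonneg d a ha; positivity
  have hin : ∀ r : Idx Λ₁ N, ∑ s ∈ T, Real.exp (-(a * sd r s)) ≤ N * latG d a := fun r =>
    (Finset.sum_le_univ_sum_of_nonneg (fun s => (Real.exp_pos _).le)).trans (sum_idx_exp_le a ha Λ₂ _)
  calc ∑ r : Idx Λ₁ N, (Real.exp (-(a * dist x (r.1 : Fin d → ℤ))) * ∑ s ∈ T, Real.exp (-(a * sd r s)))
      ≤ ∑ r : Idx Λ₁ N, Real.exp (-(a * dist x (r.1 : Fin d → ℤ))) * (N * latG d a) :=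
        Finset.sum_le_sum fun r _ => mul_le_mul_of_nonneg_left (hin r) (Real.exp_pos _).le
    _ = (∑ r : Idx Λ₁ N, Real.exp (-(a * dist x (r.1 : Fin d → ℤ)))) * (N * latG d a) := by
        rw [Finset.sum_mul]
    _ ≤ (N * latG d a) * (N * latG d a) := mul_le_mul_of_nonneg_right (sum_idx_exp_le a ha Λ₁ x) hG

/-- The (5.8)∕(5.10) constant `W = (N·G(d, μ*∕2))²·c₀·(2∕γ₀)²`. [folklore] -/
def c58 (d N : ℕ) (γ₀ c₀ δ₀ : ℝ) : ℝ :=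
  (2 / γ₀) ^ 2 * c₀ * ((N * latG d (muStar d N γ₀ c₀ δ₀ / 2)) * (N * latG d (muStar d N γ₀ c₀ δ₀ / 2)))

theorem c58_nonneg (d N : ℕ) (γ₀ c₀ δ₀ : ℝ) (hγ : 0 < γ₀) (hc : 0 ≤ c₀) (hδ : 0 < δ₀) : 0 ≤ c58 d N γ₀ c₀ δ₀ := by
  unfold c58
  have := latG_nonneg d (muStar d N γ₀ c₀ δ₀ / 2) (by have := muStar_pos d N γ₀ c₀ δ₀ hγ hc hδ; positivity)
  positivity

/-- **(5.8), uniform, by Combes–Thomas + the block identity.** [cite: Balaban1983RegularityDecay, (5.8) p.594 — proof not the print's] -/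
theorem concl58_uniform (γ₀ c₀ δ₀ : ℝ) (hγ : 0 < γ₀) (hc : 0 < c₀) (hδ : 0 < δ₀)
    (Ω : Finset (Fin d → ℤ)) (A : Matrix (Idx Ω N) (Idx Ω N) ℝ) (hA : Hyp56 Ω A γ₀ c₀ δ₀)
    (Λ : Finset (Fin d → ℤ)) (h : Λ ⊆ Ω) (p q : Idx Λ N) :
    |(compress h A)⁻¹ p q - A⁻¹ (inclIdx h p) (inclIdx h q)|
      ≤ c58 d N γ₀ c₀ δ₀ * Real.exp (-(muStar d N γ₀ c₀ δ₀ / 4 * (sd p q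
          + Metric.infDist (p.1 : Fin d → ℤ) (((Ω \ Λ : Finset (Fin d → ℤ))) : Set (Fin d → ℤ))
          + Metric.infDist (q.1 : Fin d → ℤ) (((Ω \ Λ : Finset (Fin d → ℤ))) : Set (Fin d → ℤ))))) := by
  set μ := muStar d N γ₀ c₀ δ₀ with hμdef
  have hμ0 : 0 < μ := muStar_pos d N γ₀ c₀ δ₀ hγ hc.le hδ
  have hμδ : μ ≤ δ₀ := (muStar_le d N γ₀ c₀ δ₀).trans (by linarith)
  set c := 2 / γ₀ with hcdef
  have hc0 : 0 ≤ c := by positivity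
  set out := Finset.univ.filter (fun s : Idx Ω N => (s.1 : Fin d → ℤ) ∉ Λ) with hout
  set Dp := Metric.infDist (p.1 : Fin d → ℤ) (((Ω \ Λ : Finset (Fin d → ℤ))) : Set (Fin d → ℤ)) with hDp
  set Dq := Metric.infDist (q.1 : Fin d → ℤ) (((Ω \ Λ : Finset (Fin d → ℤ))) : Set (Fin d → ℤ)) with hDq
  set D := sd p q + Dp + Dq with hDdef
  have hXu : IsUnit (compress h A).det := isUnit_det_compress h A γ₀ hγ hA.2.1
  have hYu : IsUnit A.det := by
    have := isUnit_det_compress (Finset.Subset.refl Ω) A γ₀ hγ hA.2.1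
    rwa [compress_refl] at this
  have hX : ∀ r : Idx Λ N, |(compress h A)⁻¹ p r| ≤ c * Real.exp (-(μ * sd p r)) :=
    fun r => concl57_uniform d N γ₀ c₀ δ₀ hγ hc hδ Ω A hA Λ h p r
  have hY : ∀ s : Idx Ω N, |A⁻¹ s (inclIdx h q)| ≤ c * Real.exp (-(μ * sd s q)) :=
    fun s => concl57_full γ₀ c₀ δ₀ hγ hc hδ Ω A hA s (inclIdx h q)
  have hAe : ∀ (r : Idx Λ N) (s : Idx Ω N), |A (inclIdx h r) s| ≤ c₀ * Real.exp (-(δ₀ * (sd r s + 0))) := by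
    intro r s; rw [add_zero]; exact hA.2.2 (inclIdx h r) s
  rw [deltaC_identity h A hXu hYu p q]
  have hpt : ∀ r : Idx Λ N, ∀ s ∈ out,
      |(compress h A)⁻¹ p r * A (inclIdx h r) s * A⁻¹ s (inclIdx h q)|
        ≤ c ^ 2 * c₀ * Real.exp (-(μ / 4 * D)) * (Real.exp (-(μ / 2 * sd p r)) * Real.exp (-(μ / 2 * sd r s))) := by
    intro r s hs
    have hs' : ((s.1 : Fin d → ℤ)) ∈ (((Ω \ Λ : Finset (Fin d → ℤ))) : Set (Fin d → ℤ)) := by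
      rw [Finset.mem_coe, Finset.mem_sdiff]
      exact ⟨s.1.2, (Finset.mem_filter.mp hs).2⟩
    have hDp' : Dp ≤ sd p s := Metric.infDist_le_dist_of_mem hs'
    have hDq' : Dq ≤ sd q s := Metric.infDist_le_dist_of_mem hs'
    have t1 : sd p q ≤ sd p r + sd r q := dist_triangle _ _ _
    have t2 : sd r q ≤ sd r s + sd s q := dist_triangle _ _ _
    have t3 : sd p s ≤ sd p r + sd r s := dist_triangle _ _ _
    have t4 : sd q s = sd s q := dist_comm _ _
    have hD : D ≤ 2 * (sd p r + sd r s + 0 + sd s q) := by rw [hDdef]; linarith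
    exact triple_le _ _ _ c c₀ μ δ₀ (sd p r) (sd r s) (sd s q) 0 D hc0 hc.le hμ0.le hμδ
      dist_nonneg dist_nonneg dist_nonneg le_rfl (hX r) (hAe r s) (hY s) hD
  have hW := double_sum_le (N := N) (μ / 2) (by positivity) (Λ₁ := Λ) (p.1 : Fin d → ℤ) out
  calc |∑ r : Idx Λ N, ∑ s ∈ out, (compress h A)⁻¹ p r * A (inclIdx h r) s * A⁻¹ s (inclIdx h q)|
      ≤ ∑ r : Idx Λ N, ∑ s ∈ out, |(compress h A)⁻¹ p r * A (inclIdx h r) s * A⁻¹ s (inclIdx h q)| := by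
        refine (Finset.abs_sum_le_sum_abs _ _).trans ?_
        exact Finset.sum_le_sum fun r _ => Finset.abs_sum_le_sum_abs _ _
    _ ≤ ∑ r : Idx Λ N, ∑ s ∈ out,
          c ^ 2 * c₀ * Real.exp (-(μ / 4 * D)) * (Real.exp (-(μ / 2 * sd p r)) * Real.exp (-(μ / 2 * sd r s))) :=
        Finset.sum_le_sum fun r _ => Finset.sum_le_sum fun s hs => hpt r s hs
    _ = c ^ 2 * c₀ * Real.exp (-(μ / 4 * D)) *
          ∑ r : Idx Λ N, (Real.exp (-(μ / 2 * dist (p.1 : Fin d → ℤ) (r.1 : Fin d → ℤ)))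
            * ∑ s ∈ out, Real.exp (-(μ / 2 * sd r s))) := by
        rw [Finset.mul_sum]
        refine Finset.sum_congr rfl fun r _ => ?_
        rw [Finset.mul_sum, Finset.mul_sum]
    _ ≤ c ^ 2 * c₀ * Real.exp (-(μ / 4 * D)) * ((N * latG d (μ / 2)) * (N * latG d (μ / 2))) :=
        mul_le_mul_of_nonneg_left hW (by positivity)
    _ = c58 d N γ₀ c₀ δ₀ * Real.exp (-(μ / 4 * D)) := by rw [c58, ← hμdef, ← hcdef]; ring

/-- **(5.10), uniform, by Combes–Thomas + the resolvent identity.** [cite: Balaban1983RegularityDecay, (5.10) p.594 — proof not the print's] -/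
theorem concl510_uniform (γ₀ c₀ δ₀ : ℝ) (hγ : 0 < γ₀) (hc : 0 < c₀) (hδ : 0 < δ₀)
    (Ω : Finset (Fin d → ℤ)) (A B : Matrix (Idx Ω N) (Idx Ω N) ℝ) (hA : Hyp56 Ω A γ₀ c₀ δ₀)
    (hAB : Hyp56 Ω (A + B) γ₀ c₀ δ₀) (hB : Hyp59 Ω B c₀ δ₀)
    (Λ : Finset (Fin d → ℤ)) (h : Λ ⊆ Ω) (p q : Idx Λ N) :
    |(compress h A)⁻¹ p q - (compress h (A + B))⁻¹ p q|
      ≤ c58 d N γ₀ c₀ δ₀ * Real.exp (-(muStar d N γ₀ c₀ δ₀ / 4 * (sd p q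
          + Metric.infDist (p.1 : Fin d → ℤ) ((Ω : Set (Fin d → ℤ)))ᶜ
          + Metric.infDist (q.1 : Fin d → ℤ) ((Ω : Set (Fin d → ℤ)))ᶜ))) := by
  set μ := muStar d N γ₀ c₀ δ₀ with hμdef
  have hμ0 : 0 < μ := muStar_pos d N γ₀ c₀ δ₀ hγ hc.le hδ
  have hμδ : μ ≤ δ₀ := (muStar_le d N γ₀ c₀ δ₀).trans (by linarith)
  set c := 2 / γ₀ with hcdef
  have hc0 : 0 ≤ c := by positivity
  set S : Set (Fin d → ℤ) := ((Ω : Set (Fin d → ℤ)))ᶜ with hS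
  set Dp := Metric.infDist (p.1 : Fin d → ℤ) S with hDp
  set Dq := Metric.infDist (q.1 : Fin d → ℤ) S with hDq
  set D := sd p q + Dp + Dq with hDdef
  have hXu : IsUnit (compress h A).det := isUnit_det_compress h A γ₀ hγ hA.2.1
  have hZu : IsUnit (compress h (A + B)).det := isUnit_det_compress h (A + B) γ₀ hγ hAB.2.1
  have hX : ∀ r : Idx Λ N, |(compress h A)⁻¹ p r| ≤ c * Real.exp (-(μ * sd p r)) :=
    fun r => concl57_uniform d N γ₀ c₀ δ₀ hγ hc hδ Ω A hA Λ h p r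
  have hZ : ∀ s : Idx Λ N, |(compress h (A + B))⁻¹ s q| ≤ c * Real.exp (-(μ * sd s q)) :=
    fun s => concl57_uniform d N γ₀ c₀ δ₀ hγ hc hδ Ω (A + B) hAB Λ h s q
  have hBe : ∀ r s : Idx Λ N, |compress h B r s| ≤ c₀ * Real.exp (-(δ₀ * (sd r s
      + (Metric.infDist (r.1 : Fin d → ℤ) S + Metric.infDist (s.1 : Fin d → ℤ) S)))) := by
    intro r s
    have := hB (inclIdx h r) (inclIdx h s)
    rw [compress_apply]
    simpa only [coe_inclIdx, add_assoc] using this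
  have hid := resolvent_identity h A B hXu hZu
  have hentry : (compress h A)⁻¹ p q - (compress h (A + B))⁻¹ p q
      = ∑ s : Idx Λ N, ∑ r : Idx Λ N, (compress h A)⁻¹ p r * compress h B r s * (compress h (A + B))⁻¹ s q := by
    have := congr_fun (congr_fun hid p) q
    rw [Matrix.sub_apply] at this
    rw [this, Matrix.mul_apply]
    refine Finset.sum_congr rfl fun s _ => ?_
    rw [Matrix.mul_apply, Finset.sum_mul]
  rw [hentry]
  have hpt : ∀ s r : Idx Λ N,
      |(compress h A)⁻¹ p r * compress h B r s * (compress h (A + B))⁻¹ s q|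
        ≤ c ^ 2 * c₀ * Real.exp (-(μ / 4 * D)) * (Real.exp (-(μ / 2 * sd p r)) * Real.exp (-(μ / 2 * sd r s))) := by
    intro s r
    have i1 : Dp ≤ Metric.infDist (r.1 : Fin d → ℤ) S + sd p r := Metric.infDist_le_infDist_add_dist
    have i2 : Dq ≤ Metric.infDist (s.1 : Fin d → ℤ) S + sd q s := Metric.infDist_le_infDist_add_dist
    have t1 : sd p q ≤ sd p r + sd r q := dist_triangle _ _ _
    have t2 : sd r q ≤ sd r s + sd s q := dist_triangle _ _ _
    have t4 : sd q s = sd s q := dist_comm _ _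
    have n1 : 0 ≤ sd r s := dist_nonneg
    have n2 : 0 ≤ Metric.infDist (r.1 : Fin d → ℤ) S := Metric.infDist_nonneg
    have n3 : 0 ≤ Metric.infDist (s.1 : Fin d → ℤ) S := Metric.infDist_nonneg
    have e0 : 0 ≤ Metric.infDist (r.1 : Fin d → ℤ) S + Metric.infDist (s.1 : Fin d → ℤ) S := add_nonneg n2 n3
    have hD : D ≤ 2 * (sd p r + sd r s + (Metric.infDist (r.1 : Fin d → ℤ) S + Metric.infDist (s.1 : Fin d → ℤ) S)
        + sd s q) := by rw [hDdef]; linarith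
    exact triple_le _ _ _ c c₀ μ δ₀ (sd p r) (sd r s) (sd s q) _ D hc0 hc.le hμ0.le hμδ
      dist_nonneg dist_nonneg dist_nonneg e0 (hX r) (hBe r s) (hZ s) hD
  have hW := double_sum_le (N := N) (μ / 2) (by positivity) (Λ₁ := Λ) (p.1 : Fin d → ℤ)
    (Finset.univ : Finset (Idx Λ N))
  calc |∑ s : Idx Λ N, ∑ r : Idx Λ N, (compress h A)⁻¹ p r * compress h B r s * (compress h (A + B))⁻¹ s q|
      ≤ ∑ s : Idx Λ N, ∑ r : Idx Λ N,
          |(compress h A)⁻¹ p r * compress h B r s * (compress h (A + B))⁻¹ s q| := by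
        refine (Finset.abs_sum_le_sum_abs _ _).trans ?_
        exact Finset.sum_le_sum fun s _ => Finset.abs_sum_le_sum_abs _ _
    _ ≤ ∑ s : Idx Λ N, ∑ r : Idx Λ N,
          c ^ 2 * c₀ * Real.exp (-(μ / 4 * D)) * (Real.exp (-(μ / 2 * sd p r)) * Real.exp (-(μ / 2 * sd r s))) :=
        Finset.sum_le_sum fun s _ => Finset.sum_le_sum fun r _ => hpt s r
    _ = c ^ 2 * c₀ * Real.exp (-(μ / 4 * D)) *
          ∑ r : Idx Λ N, (Real.exp (-(μ / 2 * dist (p.1 : Fin d → ℤ) (r.1 : Fin d → ℤ)))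
            * ∑ s : Idx Λ N, Real.exp (-(μ / 2 * sd r s))) := by
        rw [Finset.sum_comm, Finset.mul_sum]
        refine Finset.sum_congr rfl fun r _ => ?_
        rw [Finset.mul_sum, Finset.mul_sum]
    _ ≤ c ^ 2 * c₀ * Real.exp (-(μ / 4 * D)) * ((N * latG d (μ / 2)) * (N * latG d (μ / 2))) :=
        mul_le_mul_of_nonneg_left hW (by positivity)
    _ = c58 d N γ₀ c₀ δ₀ * Real.exp (-(μ / 4 * D)) := by rw [c58, ← hμdef, ← hcdef]; ring

/-! ## §G — the theorem -/

/-- **B4 Sect. 5 Theorem, UNIFORM reading — KERNEL-PROVED** (constants `δ₁ = μ*∕4`, `c₁ = 2∕γ₀ + c58`, functions of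
`(γ₀, c₀, δ₀, d, N)` only, as the print says on p. 597).  The print's proof (pp. 594–597) is a generalized random-walk
expansion; this proof is coercivity + exponential conjugation (Combes–Thomas 1973; Dimock arXiv:1108.1335 Lemma 30).
[cite: Balaban1983RegularityDecay, Sect. 5 Theorem (5.6)–(5.10) p.594 + p.597] -/
theorem sect5ThmUniform_holds (d N : ℕ) : Sect5ThmUniform d N := by
  intro γ₀ c₀ δ₀ hγ hc hδ
  set μ := muStar d N γ₀ c₀ δ₀ with hμdef
  have hμ0 : 0 < μ := muStar_pos d N γ₀ c₀ δ₀ hγ hc.le hδ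
  set c := 2 / γ₀ with hcdef
  have hc0 : 0 < c := by positivity
  have hW0 : 0 ≤ c58 d N γ₀ c₀ δ₀ := c58_nonneg d N γ₀ c₀ δ₀ hγ hc.le hδ
  set c₁ := c + c58 d N γ₀ c₀ δ₀ with hc₁def
  have hc₁c : c ≤ c₁ := by rw [hc₁def]; linarith
  have hc₁W : c58 d N γ₀ c₀ δ₀ ≤ c₁ := by rw [hc₁def]; linarith
  refine ⟨c₁, μ / 4, by positivity, by positivity, ?_⟩
  intro Ω A hA
  -- (5.7) with the weaker constants
  have h57 : ∀ (Λ : Finset (Fin d → ℤ)) (h : Λ ⊆ Ω) (p q : Idx Λ N),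
      |(compress h A)⁻¹ p q| ≤ c₁ * Real.exp (-(μ / 4 * sd p q)) := by
    intro Λ h p q
    have h1 := concl57_uniform d N γ₀ c₀ δ₀ hγ hc hδ Ω A hA Λ h p q
    have h2 : Real.exp (-(μ * sd p q)) ≤ Real.exp (-(μ / 4 * sd p q)) :=
      Real.exp_le_exp.mpr (by nlinarith [dist_nonneg (x := (p.1 : Fin d → ℤ)) (y := (q.1 : Fin d → ℤ))])
    calc |(compress h A)⁻¹ p q| ≤ 2 / γ₀ * Real.exp (-(μ * sd p q)) := h1
      _ ≤ c₁ * Real.exp (-(μ / 4 * sd p q)) := mul_le_mul hc₁c h2 (Real.exp_pos _).le (by positivity)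
  refine ⟨?_, ?_⟩
  · intro Λ h
    refine ⟨fun p q => h57 Λ h p q, fun p q => ?_⟩
    exact (concl58_uniform γ₀ c₀ δ₀ hγ hc hδ Ω A hA Λ h p q).trans
      (mul_le_mul_of_nonneg_right hc₁W (Real.exp_pos _).le)
  · intro B hAB hB Λ h p q
    exact (concl510_uniform γ₀ c₀ δ₀ hγ hc hδ Ω A B hA hAB hB Λ h p q).trans
      (mul_le_mul_of_nonneg_right hc₁W (Real.exp_pos _).le)

/-- The LITERAL reading follows (B4's own `sect5_literal_of_uniform`). -/
theorem sect5ThmLiteral_holds (d N : ℕ) : Sect5ThmLiteral d N :=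
  sect5_literal_of_uniform (sect5ThmUniform_holds d N)

end Stage2

end YM.NodeO.Seat4.B4Sect5

end
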